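import Mathlib
import HarnessLib
import Summits.NavierStokesRegularity.NavierStokesRegularity.Theorems.PoloidalWindowDoorPoloidalWindowRigiditySparseEnergyNearFlux

/-!
# Route `PoloidalWindowDoor`, crux `PoloidalWindowRigidity` (stmt-19708), line `sparse_energy` (cstrat g11) —
# stub S1 `stub_scaledEnergy`, near-apex bootstrap: the slice flux UNDER AN ENVELOPE (the algebra of one round, measure-free output)

Seat ns-poloidal-K2-p2 g9 (successor of the interim LEAD-of-record on 19708; file `--supports`).  `…SparseEnergyNearFlux.abs_flux_le_near` bounds the
slice flux linearly in the local energies; in a round of the bootstrap the energies at radii `2R`, `8R` and the far-field oscillation are replaced by an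
envelope value.  This file performs that substitution ONCE, with every analytic quantity abstracted to a real number, so that the rounds are pure algebra:

* `abs_flux_le_envelope` — if `∫ cutoff(2R)(a−·)|u|² ≤ l₂·K·R·P`, `∫ cutoff(8R)(a−·)|u|² ≤ l₈·K·R·P` (envelope at `2R`, `8R`; for the power envelope
  `Φ_γ`, `lⱼ = j^{1+2γ}`, `P = (R²/(−t))^γ`, `…SparseEnergyEnvelope.envelope_smul_radius`), the near pressure part obeys
  `√(∫_{B̄(a,2R)} p₁²) ≤ κ₁·M·√(∫ cutoff(8R)(a−·)|u|²)` and the far part has oscillation `O ≤ κ₂·c_f·K·P/R²` on `B̄(a,2R)` (the dyadic sum of the envelope,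
  `…Envelope.hasSum_envelope_dyadic`), then
  `|F| ≤ K·P·(l₂C_Δ/R + l₂C_∇M + 2C_∇κ₁M√(l₈l₂)) + 2C_∇κ₂c_f√(8V₁l₂)·K·P·√(K·P)/R`,  `V₁ = |B(0,1)|`
  — with `M = C/√(−t)` every term is `const·R^a(−t)^{−b}`, `b ∈ {γ, γ+½, 3γ/2}`, ready for `…PowerWeights.integral_neg_rpow`.

WHAT THIS IS NOT: not a claim about Navier–Stokes — one inequality of real numbers on top of `abs_flux_le_near` (bears_on LADDER-NS N0 via crux 19708,
line sparse_energy, stub S1). [folklore]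
-/

noncomputable section

-- the summit and its single sub-problem share the name (CONVENTIONS §1), as in every Theorems file
set_option linter.dupNamespace false

namespace Summit.NavierStokesRegularity.NavierStokesRegularity.Theorems.PoloidalWindowDoorPoloidalWindowRigiditySparseEnergyEnvFlux

open MeasureTheory Set Function Filter Topology Metric InnerProductSpace
open scoped RealInnerProductSpace InnerProductSpace Laplacian ENNReal
open Literature.Analysis Literature.Analysis.FluidPDE
open Summit.NavierStokesRegularity.NavierStokesRegularity.Theorems.PoloidalWindowDoorPoloidalWindowRigiditySparseEnergyFarFlux
open Summit.NavierStokesRegularity.NavierStokesRegularity.Theorems.PoloidalWindowDoorPoloidalWindowRigiditySparseEnergyNearFlux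

/-- The closed-ball integral is dominated by the cut-off energy at the doubled radius: `∫_{B̄(a,ρ)} |u|² ≤ ∫ cutoff ρ (a − ·)|u|²`. [folklore] -/
theorem setIntegral_closedBall_le_cutoffEnergy {u : EuclideanSpace ℝ (Fin 3) → EuclideanSpace ℝ (Fin 3)} (hu : Continuous u)
    (a : EuclideanSpace ℝ (Fin 3)) {ρ : ℝ} (hρ : 0 < ρ) :
    ∫ x in closedBall a ρ, ‖u x‖ ^ 2 ≤ ∫ x, cutoff ρ (a - x) * ‖u x‖ ^ 2 := by
  set ψ : EuclideanSpace ℝ (Fin 3) → ℝ := fun x => cutoff ρ (a - x) with hψ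
  have hv2 : Continuous fun x => ‖u x‖ ^ 2 := (hu.norm).pow 2
  have hfi : Integrable fun x => ψ x * ‖u x‖ ^ 2 :=
    ((cutoffT_contDiff hψ (n := 0)).continuous.mul hv2).integrable_of_hasCompactSupport (cutoffT_hasCompactSupport hψ hρ).mul_right
  have hball : ∫ x in closedBall a ρ, ‖u x‖ ^ 2 = ∫ x in closedBall a ρ, ψ x * ‖u x‖ ^ 2 := by
    refine setIntegral_congr_fun measurableSet_closedBall fun x hx => ?_
    rw [cutoffT_eq_one hψ hρ (mem_closedBall.1 hx), one_mul]
  rw [hball]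
  exact setIntegral_le_integral hfi (Eventually.of_forall fun x => mul_nonneg (cutoffT_nonneg_le_one hψ x).1 (sq_nonneg _))

/-- Volume of the closed ball of radius `2R` in `ℝ³`: `8R³·|B(0,1)|`. [folklore] -/
theorem volume_closedBall_two_mul_toReal (a : EuclideanSpace ℝ (Fin 3)) {R : ℝ} (hR : 0 < R) :
    (volume (closedBall a (2 * R))).toReal = 8 * R ^ 3 * (volume (ball (0 : EuclideanSpace ℝ (Fin 3)) 1)).toReal := by
  rw [Measure.addHaar_closedBall volume a (by positivity : (0 : ℝ) ≤ 2 * R), ENNReal.toReal_mul,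
    finrank_euclideanSpace, Fintype.card_fin, ENNReal.toReal_ofReal (by positivity)]
  ring

/-- **THE SLICE FLUX UNDER AN ENVELOPE.**  Inputs: the cut-off energies at radii `2R` and `8R` bounded by `l₂KRP`, `l₈KRP`, a pressure split
`p = c + p₁ + p₂` on `B̄(a,2R)` with `√(∫_{B̄}p₁²) ≤ κ₁M√(∫ cutoff(8R)|u|²)` and `osc p₂ ≤ O ≤ κ₂ c_f K P/R²`.  Output (with `V₁ = |B(0,1)|`):
`|∫(Δψ|u|² + Dψ(u)|u|² + 2pDψ(u))| ≤ K·P·(l₂C_Δ/R + l₂C_∇M + 2C_∇κ₁M√(l₈l₂)) + 2C_∇κ₂c_f√(8V₁l₂)·K·P·√(KP)/R`. [folklore] -/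
theorem abs_flux_le_envelope {R : ℝ} {a : EuclideanSpace ℝ (Fin 3)} (hR : 0 < R) {Cl Cg : ℝ}
    (hCl : ∀ R : ℝ, 0 < R → ∀ x : EuclideanSpace ℝ (Fin 3), |(Δ (cutoff R : EuclideanSpace ℝ (Fin 3) → ℝ)) x| ≤ Cl / R ^ 2)
    (hCg : ∀ R : ℝ, 0 < R → ∀ x : EuclideanSpace ℝ (Fin 3), ‖fderiv ℝ (cutoff R : EuclideanSpace ℝ (Fin 3) → ℝ) x‖ ≤ Cg / R)
    {u : EuclideanSpace ℝ (Fin 3) → EuclideanSpace ℝ (Fin 3)} {p p₁ p₂ : EuclideanSpace ℝ (Fin 3) → ℝ} {c : ℝ}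
    (hu : ContDiff ℝ 1 u) (hdiv : ∀ x, VectorCalculus.divergence u x = 0) (hp : ContDiff ℝ 1 p)
    (hp₁ : Continuous p₁) (hdec : ∀ x ∈ closedBall a (2 * R), p x = c + p₁ x + p₂ x)
    {M O K P l₂ l₈ κ₁ κ₂ cf : ℝ} (hM : 0 ≤ M) (hO : 0 ≤ O) (hK : 0 ≤ K) (hP : 0 ≤ P) (hl₂ : 0 ≤ l₂) (hl₈ : 0 ≤ l₈)
    (hκ₁ : 0 ≤ κ₁) (hκ₂ : 0 ≤ κ₂) (hcf : 0 ≤ cf) (huM : ∀ x, ‖u x‖ ≤ M)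
    (hosc : ∀ x ∈ closedBall a (2 * R), ∀ y ∈ closedBall a (2 * R), |p₂ x - p₂ y| ≤ O)
    (hE2 : ∫ x, cutoff (2 * R) (a - x) * ‖u x‖ ^ 2 ≤ l₂ * K * R * P)
    (hE8 : ∫ x, cutoff (8 * R) (a - x) * ‖u x‖ ^ 2 ≤ l₈ * K * R * P)
    (hN : Real.sqrt (∫ x in closedBall a (2 * R), p₁ x ^ 2) ≤ κ₁ * M * Real.sqrt (∫ x, cutoff (8 * R) (a - x) * ‖u x‖ ^ 2))
    (hOle : O ≤ κ₂ * cf * K * P / R ^ 2) :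
    |∫ x, ((Δ (fun x => cutoff R (a - x))) x * ‖u x‖ ^ 2 + fderiv ℝ (fun x => cutoff R (a - x)) x (u x) * ‖u x‖ ^ 2 +
        2 * (p x * fderiv ℝ (fun x => cutoff R (a - x)) x (u x)))| ≤
      K * P * (l₂ * Cl / R + l₂ * Cg * M + 2 * Cg * κ₁ * M * Real.sqrt (l₈ * l₂)) +
        2 * Cg * κ₂ * cf * Real.sqrt (8 * (volume (ball (0 : EuclideanSpace ℝ (Fin 3)) 1)).toReal * l₂) * K * P * Real.sqrt (K * P) / R := by
  set V₁ : ℝ := (volume (ball (0 : EuclideanSpace ℝ (Fin 3)) 1)).toReal with hV₁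
  have hV₁0 : 0 ≤ V₁ := ENNReal.toReal_nonneg
  have hCg0 : 0 ≤ Cg / R := le_trans (norm_nonneg _) (hCg R hR 0)
  have hCl0 : 0 ≤ Cl / R ^ 2 := le_trans (abs_nonneg _) (hCl R hR 0)
  have hCg0' : 0 ≤ Cg := by have := mul_nonneg hCg0 hR.le; rwa [div_mul_cancel₀ _ hR.ne'] at this
  have hbase := abs_flux_le_near (ψ := fun x => cutoff R (a - x)) rfl hR hCl hCg hu hdiv hp hp₁ hdec hO huM hosc
  -- the local energy on the closed ball and the two envelope values
  set I : ℝ := ∫ x in closedBall a (2 * R), ‖u x‖ ^ 2 with hI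
  have hI0 : 0 ≤ I := integral_nonneg fun x => sq_nonneg _
  have hI2 : I ≤ l₂ * K * R * P := (setIntegral_closedBall_le_cutoffEnergy hu.continuous a (by positivity)).trans hE2
  set E8 : ℝ := ∫ x, cutoff (8 * R) (a - x) * ‖u x‖ ^ 2 with hE8def
  have hQ0 : 0 ≤ K * R * P := by positivity
  -- square roots
  have hsI : Real.sqrt I ≤ Real.sqrt (l₂ * (K * R * P)) := Real.sqrt_le_sqrt (by rw [← mul_assoc, ← mul_assoc]; exact hI2)
  have hsE8 : Real.sqrt E8 ≤ Real.sqrt (l₈ * (K * R * P)) := Real.sqrt_le_sqrt (by rw [← mul_assoc, ← mul_assoc]; exact hE8)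
  have hsq2 : Real.sqrt (l₂ * (K * R * P)) = Real.sqrt l₂ * Real.sqrt (K * R * P) := Real.sqrt_mul hl₂ _
  have hsq8 : Real.sqrt (l₈ * (K * R * P)) = Real.sqrt l₈ * Real.sqrt (K * R * P) := Real.sqrt_mul hl₈ _
  have hQQ : Real.sqrt (K * R * P) * Real.sqrt (K * R * P) = K * R * P := Real.mul_self_sqrt hQ0
  have hsKRP : Real.sqrt (K * R * P) = Real.sqrt R * Real.sqrt (K * P) := by
    rw [show K * R * P = R * (K * P) by ring, Real.sqrt_mul hR.le]
  have hsV : Real.sqrt (volume (closedBall a (2 * R))).toReal = Real.sqrt (8 * V₁) * (R * Real.sqrt R) := by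
    rw [volume_closedBall_two_mul_toReal a hR, ← hV₁, show 8 * R ^ 3 * V₁ = (8 * V₁) * (R ^ 2 * R) by ring,
      Real.sqrt_mul (by positivity), Real.sqrt_mul (sq_nonneg R), Real.sqrt_sq hR.le]
  have hl82 : Real.sqrt l₈ * Real.sqrt l₂ = Real.sqrt (l₈ * l₂) := (Real.sqrt_mul hl₈ l₂).symm
  -- term by term
  have hT1 : Cl / R ^ 2 * I ≤ K * P * (l₂ * Cl / R) := by
    calc Cl / R ^ 2 * I ≤ Cl / R ^ 2 * (l₂ * K * R * P) := mul_le_mul_of_nonneg_left hI2 hCl0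
      _ = K * P * (l₂ * Cl / R) := by field_simp
  have hT2 : Cg / R * M * I ≤ K * P * (l₂ * Cg * M) := by
    calc Cg / R * M * I ≤ Cg / R * M * (l₂ * K * R * P) := mul_le_mul_of_nonneg_left hI2 (mul_nonneg hCg0 hM)
      _ = K * P * (l₂ * Cg * M) := by field_simp
  have hN' : Real.sqrt (∫ x in closedBall a (2 * R), p₁ x ^ 2) ≤ κ₁ * M * (Real.sqrt l₈ * Real.sqrt (K * R * P)) :=
    hN.trans (by rw [← hsq8]; exact mul_le_mul_of_nonneg_left hsE8 (mul_nonneg hκ₁ hM))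
  have hT3 : Real.sqrt (∫ x in closedBall a (2 * R), p₁ x ^ 2) * Real.sqrt I ≤ κ₁ * M * Real.sqrt (l₈ * l₂) * (K * R * P) := by
    calc Real.sqrt (∫ x in closedBall a (2 * R), p₁ x ^ 2) * Real.sqrt I
        ≤ (κ₁ * M * (Real.sqrt l₈ * Real.sqrt (K * R * P))) * (Real.sqrt l₂ * Real.sqrt (K * R * P)) :=
          mul_le_mul hN' (hsq2 ▸ hsI) (Real.sqrt_nonneg _) (by positivity)
      _ = κ₁ * M * (Real.sqrt l₈ * Real.sqrt l₂) * (Real.sqrt (K * R * P) * Real.sqrt (K * R * P)) := by ring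
      _ = κ₁ * M * Real.sqrt (l₈ * l₂) * (K * R * P) := by rw [hl82, hQQ]
  have hT4 : O * Real.sqrt (volume (closedBall a (2 * R))).toReal * Real.sqrt I ≤
      (κ₂ * cf * K * P / R ^ 2) * (Real.sqrt (8 * V₁) * (R * Real.sqrt R)) * (Real.sqrt l₂ * (Real.sqrt R * Real.sqrt (K * P))) := by
    rw [hsV]
    refine mul_le_mul (mul_le_mul_of_nonneg_right hOle (by positivity)) (by rw [← hsKRP, ← hsq2]; exact hsI)
      (Real.sqrt_nonneg _) (by positivity)
  -- assemble
  refine hbase.trans ?_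
  have hsum3 : 2 * (Cg / R) * (Real.sqrt (∫ x in closedBall a (2 * R), p₁ x ^ 2) * Real.sqrt I +
      O * Real.sqrt (volume (closedBall a (2 * R))).toReal * Real.sqrt I) ≤
      2 * (Cg / R) * (κ₁ * M * Real.sqrt (l₈ * l₂) * (K * R * P) +
        (κ₂ * cf * K * P / R ^ 2) * (Real.sqrt (8 * V₁) * (R * Real.sqrt R)) * (Real.sqrt l₂ * (Real.sqrt R * Real.sqrt (K * P)))) :=
    mul_le_mul_of_nonneg_left (add_le_add hT3 hT4) (by positivity)
  have hsRR : Real.sqrt R ^ 2 = R := Real.sq_sqrt hR.le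
  have hs8 : Real.sqrt (8 * V₁ * l₂) = Real.sqrt (8 * V₁) * Real.sqrt l₂ := Real.sqrt_mul (by positivity) _
  have e : 2 * (Cg / R) * (κ₁ * M * Real.sqrt (l₈ * l₂) * (K * R * P) +
        (κ₂ * cf * K * P / R ^ 2) * (Real.sqrt (8 * V₁) * (R * Real.sqrt R)) * (Real.sqrt l₂ * (Real.sqrt R * Real.sqrt (K * P)))) =
      K * P * (2 * Cg * κ₁ * M * Real.sqrt (l₈ * l₂)) +
        2 * Cg * κ₂ * cf * Real.sqrt (8 * V₁ * l₂) * K * P * Real.sqrt (K * P) / R := by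
    rw [hs8]
    have hw2 : Real.sqrt R ^ 2 = R := hsRR
    have hw0 : Real.sqrt R ≠ 0 := (Real.sqrt_pos.2 hR).ne'
    generalize Real.sqrt R = w at hw2 hw0 ⊢
    subst hw2
    field_simp
  linarith [hT1, hT2, hsum3, e.le, e.ge]

end Summit.NavierStokesRegularity.NavierStokesRegularity.Theorems.PoloidalWindowDoorPoloidalWindowRigiditySparseEnergyEnvFlux

end
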